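import Summits.Ventures.Crystal3D.Bulk.CapBoxKernelPoly
import Literature.LinearAlgebra.Matrix.PermanentModTwoPowSteps
import HarnessLib

/-!
# Tensor-Bernstein branch and bound with an S-procedure acceptance test

Venture `Crystal3D` (cell `pub-crystal3d`, phase 2; seat typer-bulk). The plain search of `CapBoxSearch.lean`
certifies a box only when the target's Bernstein coefficients are all `≥ θ` or the Gram tensor's are all `< η`;
an inequality that is TIGHT ON THE GRAM BOUNDARY inside a box can never be separated that way. Here the Gram
polynomial is carried in the SAME degree `n` as the target, and a box is also accepted when, for a rational
`σ ≥ 0` read off the data, every coefficient of `(Y - θ) - σ·(H - η)` is `≥ 0` (S-procedure: on the admissible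
part `H`-value `≥ η`, hence `Y`-value `≥ θ`) — the acceptance rule of the cell's external checkers
(theory-2 `verify2-cap`, idea-2 `bb3s`).

* `sprocW`, `sigmaOf`, `sprocAccept` and `le_val3N_of_sprocAccept` (soundness of the box rule; the `zipWith`
  indexing lemma is reused from `Literature.LinearAlgebra.Matrix.PermMod2`);
* `bnbS` / `bnbS_sound`; `checkPos3S` / `nonneg_of_checkPos3S` (same statement as `nonneg_of_checkPos3`).
HONEST FRAMING: bookkeeping [folklore: Putinar/S-procedure relaxation on Bernstein coefficients]; nothing geometric.
-/

open Finset

namespace Summit.Ventures.Crystal3D.CapCut.Bern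

/-! ### The S-procedure box rule -/

/-- The combined rational tensor `W = (Y - θ) - σ·(H - η)` (entrywise; equal shapes). [folklore] -/
def sprocW (σ : ℚ) (θ η : ℕ) (Y H : T3) : QT3 :=
  List.zipWith (fun sl hl => List.zipWith (fun ln hn =>
    List.zipWith (fun (y h : ℕ) => ((y : ℚ) - θ) - σ * ((h : ℚ) - η)) ln hn) sl hl) Y H

/-- All entries of a rational tensor are `≥ 0`. [folklore] -/
def allNonneg3 (W : QT3) : Bool := W.all fun sl => sl.all fun ln => ln.all fun q => decide (0 ≤ q)

/-- Fold a minimum of `(y-θ)/(h-η)` over the entries with `h > η` (starting value `start`). [folklore] -/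
def sigmaFold (θ η : ℕ) (Y H : T3) (start : ℚ) : ℚ :=
  (List.zipWith (fun sl hl => List.zipWith (fun ln hn => List.zipWith (fun (y h : ℕ) =>
      if η < h then some ((((y : ℚ) - θ)) / ((h : ℚ) - η)) else none) ln hn) sl hl) Y H).foldr
    (fun sl acc => sl.foldr (fun ln acc' => ln.foldr (fun o a => match o with | some q => min q a | none => a) acc') acc)
    start

/-- The multiplier: the largest `σ` allowed by the entries with `h > η`, capped at `start = 2^60` and floored
at `0`. (Soundness does not depend on this choice.) [folklore] -/
def sigmaOf (θ η : ℕ) (Y H : T3) : ℚ := max 0 (sigmaFold θ η Y H (2 ^ 60))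

/-- **The S-procedure acceptance test.** [folklore] -/
def sprocAccept (θ η : ℕ) (Y H : T3) : Bool := allNonneg3 (sprocW (sigmaOf θ η Y H) θ η Y H)

/-- Length of `zipWith` on equal lengths. [folklore] -/
theorem length_zipWith_eq {α β γ : Type} (f : α → β → γ) (a : List α) (b : List β) {m : ℕ}
    (ha : a.length = m) (hb : b.length = m) : (List.zipWith f a b).length = m := by
  rw [List.length_zipWith, ha, hb, min_self]

/-- A level of the combination: if `F (f x y) = (F₁ x - θ) - σ (F₂ y - η)` entrywise then the Bernstein value
of `zipWith f a b` is `(bvF F₁ a - θ) - σ (bvF F₂ b - η)` (full-length lists). [folklore] -/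
theorem bvF_zipWith_affine {α β γ : Type} {F : γ → ℝ} {z : γ} {F₁ : α → ℝ} {z₁ : α} {F₂ : β → ℝ} {z₂ : β}
    (f : α → β → γ) (σ θ η : ℝ) (n : ℕ) (a : List α) (b : List β) (ha : a.length = n + 1)
    (hb : b.length = n + 1) (s : ℝ) (hf : ∀ x ∈ a, ∀ y ∈ b, F (f x y) = (F₁ x - θ) - σ * (F₂ y - η)) :
    bvF F z n (List.zipWith f a b) s = (bvF F₁ z₁ n a s - θ) - σ * (bvF F₂ z₂ n b s - η) := by
  unfold bvF
  have hθ : θ = ∑ i ∈ range (n + 1), bern n i s * θ := by rw [← Finset.sum_mul, sum_bern, one_mul]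
  have hη : η = ∑ i ∈ range (n + 1), bern n i s * η := by rw [← Finset.sum_mul, sum_bern, one_mul]
  rw [hθ, hη, ← Finset.sum_sub_distrib, ← Finset.sum_sub_distrib, Finset.mul_sum, ← Finset.sum_sub_distrib]
  refine Finset.sum_congr rfl fun i hi => ?_
  have hi' : i < n + 1 := by simpa using hi
  rw [Literature.LinearAlgebra.Matrix.PermMod2.getD_zipWith_of_lt f a b (by omega) (by omega) z z₁ z₂,
    hf _ (getD_mem_of_lt a z₁ (by omega)) _ (getD_mem_of_lt b z₂ (by omega))]
  ring

/-- **The combination tensor's value**: for tensors of shape `(n+1)³`,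
`val3Q n (sprocW σ θ η Y H) s = (val3N n Y s - θ) - σ·(val3N n H s - η)` on any `s`. [folklore] -/
theorem val3Q_sprocW (n : ℕ) (σ : ℚ) (θ η : ℕ) (Y H : T3) (hY : Shape3 n Y) (hH : Shape3 n H) (s1 s2 s3 : ℝ) :
    val3Q n (sprocW σ θ η Y H) s1 s2 s3 =
      (val3N n Y s1 s2 s3 - θ) - (σ : ℝ) * (val3N n H s1 s2 s3 - η) := by
  unfold val3Q val3N sprocW
  refine bvF_zipWith_affine _ (σ : ℝ) (θ : ℝ) (η : ℝ) n Y H hY.1 hH.1 s1 fun sl hsl hl hhl => ?_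
  refine bvF_zipWith_affine _ (σ : ℝ) (θ : ℝ) (η : ℝ) n sl hl (hY.2 sl hsl).1 (hH.2 hl hhl).1 s2
    fun ln hln hn hhn => ?_
  refine bvF_zipWith_affine _ (σ : ℝ) (θ : ℝ) (η : ℝ) n ln hn ((hY.2 sl hsl).2 ln hln) ((hH.2 hl hhl).2 hn hhn) s3
    fun y _ h _ => ?_
  push_cast; ring

/-- Members of `zipWith`. [folklore] -/
theorem forall_mem_zipWith {α β γ : Type} (f : α → β → γ) (Q : γ → Prop) :
    ∀ (a : List α) (b : List β), (∀ x ∈ a, ∀ y ∈ b, Q (f x y)) → ∀ w ∈ List.zipWith f a b, Q w := by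
  intro a
  induction a with
  | nil => intro b _ w hw; simp at hw
  | cons x a ih =>
    intro b h w hw
    cases b with
    | nil => simp at hw
    | cons y b =>
      simp only [List.zipWith_cons_cons, List.mem_cons] at hw
      rcases hw with rfl | hw
      · exact h x (by simp) y (by simp)
      · exact ih b (fun x' hx' y' hy' => h x' (by simp [hx']) y' (by simp [hy'])) w hw

/-- Shape of the combination tensor. [folklore] -/
theorem shape3_sprocW (n : ℕ) (σ : ℚ) (θ η : ℕ) (Y H : T3) (hY : Shape3 n Y) (hH : Shape3 n H) :
    Shape3 n (sprocW σ θ η Y H) := by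
  unfold sprocW
  refine ⟨length_zipWith_eq _ Y H hY.1 hH.1, ?_⟩
  refine forall_mem_zipWith _ _ Y H fun a ha b hb => ?_
  refine ⟨length_zipWith_eq _ a b (hY.2 a ha).1 (hH.2 b hb).1, ?_⟩
  refine forall_mem_zipWith _ _ a b fun x hx y hy => ?_
  exact length_zipWith_eq _ x y ((hY.2 a ha).2 x hx) ((hH.2 b hb).2 y hy)

/-- All entries `≥ 0` ⇒ Bernstein value `≥ 0` on the cube (rational tensors of shape `(n+1)³`). [folklore] -/
theorem val3Q_nonneg_of_allNonneg3 (n : ℕ) (W : QT3) (hW : Shape3 n W) (h : allNonneg3 W = true)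
    {s1 s2 s3 : ℝ} (h10 : 0 ≤ s1) (h11 : s1 ≤ 1) (h20 : 0 ≤ s2) (h21 : s2 ≤ 1) (h30 : 0 ≤ s3) (h31 : s3 ≤ 1) :
    0 ≤ val3Q n W s1 s2 s3 := by
  simp only [allNonneg3, List.all_eq_true, decide_eq_true_eq] at h
  unfold val3Q
  refine le_bvF_of_forall n W 0 (fun a ha => ?_) h10 h11
  have hsl := getD_mem_of_lt W [] (by rw [hW.1]; omega : a < W.length)
  refine le_bvF_of_forall n _ 0 (fun b hb => ?_) h20 h21
  have hln := getD_mem_of_lt (W.getD a []) [] (by rw [(hW.2 _ hsl).1]; omega : b < (W.getD a []).length)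
  refine le_bvF_of_forall n _ 0 (fun c hc => ?_) h30 h31
  have hx := getD_mem_of_lt ((W.getD a []).getD b []) 0
    (by rw [(hW.2 _ hsl).2 _ hln]; omega : c < ((W.getD a []).getD b []).length)
  exact_mod_cast h _ hsl _ hln _ hx

/-- **Soundness of the S-procedure box rule**: if accepted, wherever the `H`-value is `≥ η` on the cube,
the `Y`-value is `≥ θ`. [folklore] -/
theorem le_val3N_of_sprocAccept (n θ η : ℕ) (Y H : T3) (hY : Shape3 n Y) (hH : Shape3 n H)
    (h : sprocAccept θ η Y H = true) {s1 s2 s3 : ℝ} (h10 : 0 ≤ s1) (h11 : s1 ≤ 1) (h20 : 0 ≤ s2) (h21 : s2 ≤ 1)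
    (h30 : 0 ≤ s3) (h31 : s3 ≤ 1) (hval : (η : ℝ) ≤ val3N n H s1 s2 s3) : (θ : ℝ) ≤ val3N n Y s1 s2 s3 := by
  unfold sprocAccept at h
  set σ := sigmaOf θ η Y H with hσ
  have hσ0 : (0 : ℝ) ≤ (σ : ℝ) := by
    have : (0 : ℚ) ≤ σ := by rw [hσ]; unfold sigmaOf; exact le_max_left _ _
    exact_mod_cast this
  have hW := val3Q_nonneg_of_allNonneg3 n _ (shape3_sprocW n σ θ η Y H hY hH) h h10 h11 h20 h21 h30 h31
  rw [val3Q_sprocW n σ θ η Y H hY hH] at hW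
  have : (0 : ℝ) ≤ (σ : ℝ) * (val3N n H s1 s2 s3 - η) := mul_nonneg hσ0 (by linarith)
  linarith

/-! ### The search with the extra rule -/

/-- The branch and bound with the S-procedure rule (target and Gram tensors both of degree `n`). [folklore] -/
def bnbS (n : ℕ) : ℕ → ℕ → T3 → ℕ → T3 → ℕ → Bool
  | 0, _, _, _, _, _ => false
  | fuel + 1, ax, Y, θ, H, η =>
    allGe3 θ Y ||
      (allLt3 η H ||
        (sprocAccept θ η Y H ||
          (bnbS n fuel (nextAx ax) (splitL ax Y) (sc0 n θ) (splitL ax H) (sc0 n η) &&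
            bnbS n fuel (nextAx ax) (splitR ax Y) (sc0 n θ) (splitR ax H) (sc0 n η))))

set_option maxHeartbeats 800000 in
/-- **Soundness of the search with the S-procedure rule.** [folklore] -/
theorem bnbS_sound (n : ℕ) : ∀ (fuel ax : ℕ) (Y : T3) (θ : ℕ) (H : T3) (η : ℕ),
    bnbS n fuel ax Y θ H η = true → Shape3 n Y → Shape3 n H →
    ∀ s1 s2 s3 : ℝ, 0 ≤ s1 → s1 ≤ 1 → 0 ≤ s2 → s2 ≤ 1 → 0 ≤ s3 → s3 ≤ 1 →
      (η : ℝ) ≤ val3N n H s1 s2 s3 → (θ : ℝ) ≤ val3N n Y s1 s2 s3 := by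
  intro fuel
  induction fuel with
  | zero => intro ax Y θ H η h; simp [bnbS] at h
  | succ fuel ih =>
    intro ax Y θ H η h hY hH s1 s2 s3 h10 h11 h20 h21 h30 h31 hval
    simp only [bnbS, Bool.or_eq_true, Bool.and_eq_true] at h
    rcases h with hge | hlt | hsp | ⟨hl, hr⟩
    · exact le_val3N_of_allGe3 n Y hY θ hge h10 h11 h20 h21 h30 h31
    · exact absurd hval (not_le.2 (val3N_lt_of_allLt3 n H hH η hlt h10 h11 h20 h21 h30 h31))
    · exact le_val3N_of_sprocAccept n θ η Y H hY hH hsp h10 h11 h20 h21 h30 h31 hval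
    · have ihL := ih _ _ _ _ _ hl (shape3_splitL n ax Y hY) (shape3_splitL n ax H hH)
      have ihR := ih _ _ _ _ _ hr (shape3_splitR n ax Y hY) (shape3_splitR n ax H hH)
      match ax with
      | 0 =>
        exact split_step n n θ η (fun x => val3N n Y x s2 s3) (fun x => val3N n H x s2 s3)
          (fun x => val3N n (splitL 0 Y) x s2 s3) (fun x => val3N n (splitL 0 H) x s2 s3)
          (fun x => val3N n (splitR 0 Y) x s2 s3) (fun x => val3N n (splitR 0 H) x s2 s3)
          (fun x => val3N_splitL0 n Y hY x s2 s3) (fun x => val3N_splitL0 n H hH x s2 s3)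
          (fun x => val3N_splitR0 n Y hY x s2 s3) (fun x => val3N_splitR0 n H hH x s2 s3)
          (fun s' h0' h1' hv => ihL s' s2 s3 h0' h1' h20 h21 h30 h31 hv)
          (fun s' h0' h1' hv => ihR s' s2 s3 h0' h1' h20 h21 h30 h31 hv) s1 h10 h11 hval
      | 1 =>
        exact split_step n n θ η (fun x => val3N n Y s1 x s3) (fun x => val3N n H s1 x s3)
          (fun x => val3N n (splitL 1 Y) s1 x s3) (fun x => val3N n (splitL 1 H) s1 x s3)
          (fun x => val3N n (splitR 1 Y) s1 x s3) (fun x => val3N n (splitR 1 H) s1 x s3)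
          (fun x => val3N_splitL1 n Y hY s1 x s3) (fun x => val3N_splitL1 n H hH s1 x s3)
          (fun x => val3N_splitR1 n Y hY s1 x s3) (fun x => val3N_splitR1 n H hH s1 x s3)
          (fun s' h0' h1' hv => ihL s1 s' s3 h10 h11 h0' h1' h30 h31 hv)
          (fun s' h0' h1' hv => ihR s1 s' s3 h10 h11 h0' h1' h30 h31 hv) s2 h20 h21 hval
      | k + 2 =>
        exact split_step n n θ η (fun x => val3N n Y s1 s2 x) (fun x => val3N n H s1 s2 x)
          (fun x => val3N n (splitL (k + 2) Y) s1 s2 x) (fun x => val3N n (splitL (k + 2) H) s1 s2 x)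
          (fun x => val3N n (splitR (k + 2) Y) s1 s2 x) (fun x => val3N n (splitR (k + 2) H) s1 s2 x)
          (fun x => val3N_splitL2 n k Y hY s1 s2 x) (fun x => val3N_splitL2 n k H hH s1 s2 x)
          (fun x => val3N_splitR2 n k Y hY s1 s2 x) (fun x => val3N_splitR2 n k H hH s1 s2 x)
          (fun s' h0' h1' hv => ihL s1 s2 s' h10 h11 h20 h21 h0' h1' hv)
          (fun s' h0' h1' hv => ihR s1 s2 s' h10 h11 h20 h21 h0' h1' hv) s3 h30 h31 hval

/-! ### End to end -/

/-- The complete check with the S-procedure rule: as `checkPos3`, with the Gram polynomial padded to degree `n`.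
[folklore] -/
def checkPos3S (P : QT3) (n : ℕ) (lo0 hi0 lo1 hi1 lo2 hi2 : ℚ) (NB NGB fuel : ℕ) : Bool :=
  let B := toBern3 lo0 hi0 lo1 hi1 lo2 hi2 P
  let N : ℕ := 2 ^ NB
  let M : ℕ := (-(⌊(N : ℚ) * minEntry3 B⌋)).toNat
  let G := toBern3 lo0 hi0 lo1 hi1 lo2 hi2 (pad3 n gramQ3)
  let NG : ℕ := 2 ^ NGB
  let MG : ℕ := (-(⌊(NG : ℚ) * minEntry3 G⌋)).toNat + 1
  shapeOK3 n P && shapeOK3 n (pad3 n gramQ3) && decide (lo0 < hi0) && decide (lo1 < hi1) && decide (lo2 < hi2) &&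
    offsetOK N M B && offsetOKUp NG MG G &&
      bnbS n fuel 0 (toNat3 N M B) M (toNat3Up NG MG G) MG

/-- **Soundness of the check with the S-procedure rule** (same statement as `nonneg_of_checkPos3`). [folklore] -/
theorem nonneg_of_checkPos3S (P : QT3) (n : ℕ) (lo0 hi0 lo1 hi1 lo2 hi2 : ℚ) (NB NGB fuel : ℕ)
    (h : checkPos3S P n lo0 hi0 lo1 hi1 lo2 hi2 NB NGB fuel = true) :
    ∀ u v t : ℝ, (lo0 : ℝ) ≤ u → u ≤ hi0 → (lo1 : ℝ) ≤ v → v ≤ hi1 → (lo2 : ℝ) ≤ t → t ≤ hi2 →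
      0 ≤ 1 + 2 * u * v * t - u ^ 2 - v ^ 2 - t ^ 2 → 0 ≤ eval3 P u v t := by
  intro u v t hu0 hu1 hv0 hv1 ht0 ht1 hgram
  simp only [checkPos3S, Bool.and_eq_true, decide_eq_true_eq] at h
  obtain ⟨⟨⟨⟨⟨⟨⟨hshape, hshapeG⟩, hl0⟩, hl1⟩, hl2⟩, hoff⟩, hoffG⟩, hbnb⟩ := h
  set B := toBern3 lo0 hi0 lo1 hi1 lo2 hi2 P with hB
  set G := toBern3 lo0 hi0 lo1 hi1 lo2 hi2 (pad3 n gramQ3) with hG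
  set N : ℕ := 2 ^ NB with hN
  set NG : ℕ := 2 ^ NGB with hNG
  set M : ℕ := (-(⌊(N : ℚ) * minEntry3 B⌋)).toNat with hM
  set MG : ℕ := (-(⌊(NG : ℚ) * minEntry3 G⌋)).toNat + 1 with hMG
  have hP : Shape3 n P := shape3_of_shapeOK3 n P hshape
  have hPG : Shape3 n (pad3 n gramQ3) := shape3_of_shapeOK3 n _ hshapeG
  have hBs : Shape3 n B := shape3_toBern3 n _ _ _ _ _ _ P hP
  have hGs : Shape3 n G := shape3_toBern3 n _ _ _ _ _ _ _ hPG
  have hYs : Shape3 n (toNat3 N M B) := shape3_map3 n _ B hBs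
  have hHs : Shape3 n (toNat3Up NG MG G) := shape3_map3 n _ G hGs
  have d0 : (0 : ℝ) < hi0 - lo0 := by
    have h' : ((lo0 : ℚ) : ℝ) < hi0 := by exact_mod_cast hl0
    linarith
  have d1 : (0 : ℝ) < hi1 - lo1 := by
    have h' : ((lo1 : ℚ) : ℝ) < hi1 := by exact_mod_cast hl1
    linarith
  have d2 : (0 : ℝ) < hi2 - lo2 := by
    have h' : ((lo2 : ℚ) : ℝ) < hi2 := by exact_mod_cast hl2
    linarith
  set s1 := (u - lo0) / (hi0 - lo0) with hs1
  set s2 := (v - lo1) / (hi1 - lo1) with hs2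
  set s3 := (t - lo2) / (hi2 - lo2) with hs3
  have h10 : 0 ≤ s1 := div_nonneg (by linarith) d0.le
  have h11 : s1 ≤ 1 := (div_le_one d0).2 (by linarith)
  have h20 : 0 ≤ s2 := div_nonneg (by linarith) d1.le
  have h21 : s2 ≤ 1 := (div_le_one d1).2 (by linarith)
  have h30 : 0 ≤ s3 := div_nonneg (by linarith) d2.le
  have h31 : s3 ≤ 1 := (div_le_one d2).2 (by linarith)
  have e0 : (lo0 : ℝ) * (1 - s1) + hi0 * s1 = u := by rw [hs1]; field_simp; ring
  have e1 : (lo1 : ℝ) * (1 - s2) + hi1 * s2 = v := by rw [hs2]; field_simp; ring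
  have e2 : (lo2 : ℝ) * (1 - s3) + hi2 * s3 = t := by rw [hs3]; field_simp; ring
  have hHval : (MG : ℝ) ≤ val3N n (toNat3Up NG MG G) s1 s2 s3 := by
    have hup := le_val3N_toNat3Up n G hGs NG MG hoffG h10 h11 h20 h21 h30 h31
    rw [hG, val3Q_toBern3 n _ hPG, e0, e1, e2, eval3_pad3, eval3_gramQ3] at hup
    have : (0 : ℝ) ≤ (NG : ℝ) * (1 + 2 * u * v * t - u ^ 2 - v ^ 2 - t ^ 2) := by positivity
    linarith
  have hY := bnbS_sound n fuel 0 _ M _ MG hbnb hYs hHs s1 s2 s3 h10 h11 h20 h21 h30 h31 hHval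
  have hle := val3N_toNat3_le n B hBs N M hoff h10 h11 h20 h21 h30 h31
  rw [hB, val3Q_toBern3 n P hP, e0, e1, e2] at hle
  have hNpos : (0 : ℝ) < N := by rw [hN]; positivity
  have hNe : (0 : ℝ) ≤ (N : ℝ) * eval3 P u v t := by linarith
  by_contra hneg
  push Not at hneg
  have : (N : ℝ) * eval3 P u v t < 0 := mul_neg_of_pos_of_neg hNpos hneg
  linarith

end Summit.Ventures.Crystal3D.CapCut.Bern
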